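import Literature.MathematicalPhysics.QuantumLattice.GibbsStationaritySlack
import HarnessLib

/-!
# The Ward–Bogoliubov BORDER rows: the `k = 0` double-commutator block of a ground state is positive
# semidefinite, and its Ward entry is fixed by the source — first lemmas of card
# `sourced-kkt-one-point-floor` (addendum `ward-bogoliubov-border-rows`)

Cell `hubbard-cq` (D-0082 (c) / D-0085), lead ASSIGN 2026-08-26T23:21Z to seat `hubbard-cq-p1`; statements =
`hubbard-cq-lens-transplant-2` g2's `HOME/lean/WardBogoliubovSketch-transplant2.lean` (`WardIdentity`, `DCommBlockPSD`,
`WBScalar`), proved here model-free over `Matrix` (census (41) WARD–BOGOLIUBOV BORDER). SETTING: a SOURCED Hamiltonian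
`A(h) = K − h·(Δ + Δᴴ)` with a conserved charge `G` of `K` (`KG = GK`, `G` Hermitian) under which the source word has
charge one (`GΔ − ΔG = −Δ`; for the `d`-wave pair field `Δ = Δ_d`, `G = N/2`); `O := Δ + Δᴴ`, rotated source
`P := i(Δ − Δᴴ)`.

* §1 (W) `ward_doubleCommutator`: `[G, [A(h), G]] = h·O` — the `k = 0` transverse-susceptibility sum rule; also
  `[A(h), G] = −h(Δ − Δᴴ)` (`sourced_comm_charge`).
* §2 (DCommBlockPSD) `posSemidef_doubleCommutatorBlock`: for EVERY Hermitian `H`, every ground-state vector `ψ`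
  (`Matrix.IsGroundStateVector`) and every finite word family `X : m → Matrix`, the block
  `D_ab = ⟨ψ, ((X a)ᴴ[H, X b] − [H, X b](X a)ᴴ) ψ⟩` (the summand shape of the tree's `dcommForm`) is
  `Matrix.PosSemidef`: `D = Vᴴ(H − E₀)V + (Wᴴ(H − E₀)W)ᵀ` with the rectangular Gram data `V_{·b} = X_b ψ`,
  `W_{·b} = X_bᴴ ψ` and `H − E₀ ⪰ 0` (`posSemidef_sub_groundEnergy`) — entry identity
  `star_dotProduct_doubleCommutator_mulVec`.
* §3 (WBScalar) `ward_bogoliubov_scalar`: for `0 < h`, every ground-state vector `ψ` of `A(h)` and EVERY matrix `Y`,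
  `h·‖⟨ψ, [P, Y]ψ⟩‖² ≤ Re⟨ψ, Oψ⟩ · Re⟨ψ, [Yᴴ, [A(h), Y]]ψ⟩` — the `2 × 2` case `X = (G, Y)` of §2: its determinant is
  nonnegative, the `(G,G)` entry is `h·⟨O⟩` by (W), and the off-diagonal entry is `h·⟨[Δ − Δᴴ, Y]⟩` by Jacobi + the
  first-order row `⟨ψ,[A,·]ψ⟩ = 0` (`dotProduct_comm_mulVec_eq_zero`). The `T = 0` Bogoliubov / Pitaevskii–Stringari
  inequality with the broken generator, whose Gram entry the source FIXES; read as a floor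
  `Re⟨O⟩ ≥ h‖⟨[P,Y]⟩‖²/Re⟨[Yᴴ,[A,Y]]⟩` it is the border row of the card.

ANSWER to transplant-2's question «is the border an INSTANCE of p471916 (`Rows/SourcedTorusRowsOnePointKKT`)'s
`Bk` word list?» (after reading p471916, `StateRelaxationKKT.kktForm`, `HubbardLadder/DoubleCommutatorBlocks.dcommForm`):
NO, not as typed. p471916's generators are PATCH words `Bk : β → FermionOp Λ` embedded by `fermionEmbed (PolySite.incl hΛ)`,
and its soundness goes through `kktForm` rows `ω(Bᴴ[H,B]) ≥ 0`; the border's generators are TORUS-WIDE zero-momentum sums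
(`G = N/2 = ½Σ_x n_x` and, usefully, `Y(0) = Σ_x τ_x Y`), whose `kktForm` parents `ω(X(0)ᴴ[H,Y(0)])` are NON-local (all
separations) and not program-expressible, while the DOUBLE commutator `[X(0)ᴴ,[H_L,Y(0)]]` IS a finite sum of patch words
(range ≤ r_X + r_Y + range H) and its `(G,G)` entry is the Ward value `h·O_L` — that asymmetry is the content of the border.
What a certificate consumer needs on top of this file: a HOOK «zero-momentum dcomm block» — for the torus ground state
and patch words `X, Y`, `L⁻²·ω([X(0)ᴴ,[A_L(h),Y(0)]]) = ω̄(Σ_{y ∈ box} [Xᴴ,[H^{src}_{Λ'}, τ_y Y]])` for `L ≥ L₀` (locality +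
translation invariance, same shape as `SourcedTorusRowsKKTHook`), after which the border is one more PSD-paired summand in
a p471916-type `hcert` identity, sound by §2 (with `X 0 := N/2` a torus-wide generator — §2 allows ANY matrices).

HONEST FRAMING: finite-dimensional linear algebra; the rows are constraints valid in every ground state of the SOURCED
problem at fixed `h > 0` (T1 / W1 «finite-h response» objects); nothing here is a number, an order parameter or a phase
word. No definition, no named fact, no `sorry`.

References: L. Pitaevskii, S. Stringari, J. Low Temp. Phys. 85 (1991) 377, §2 (uncertainty-principle / Bogoliubov
inequalities at `T = 0`, the double-commutator «f-sum» matrix) [PitaevskiiStringari1991]; H. Wagner, Z. Physik 195 (1966)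
273, §II (Bogoliubov inequality with a symmetry-breaking field) [Wagner1966]; O. Bratteli, D. W. Robinson, Operator
Algebras and Quantum Statistical Mechanics II (1997), Prop. 5.3.19 (ground states: `ω(Aᴴ[H,A]) ≥ 0`) [BratteliRobinsonII1997].
-/

noncomputable section

namespace Summit.Ventures.CertifiedManyBodySolver.Observables

open Matrix Literature.MathematicalPhysics.QuantumLattice
open scoped ComplexOrder

variable {n : Type*} [Fintype n] [DecidableEq n]

/-! ### §1 The Ward identity of the sourced Hamiltonian -/

section Ward

variable {K G Δ : Matrix n n ℂ}

omit [DecidableEq n] in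
/-- The adjoint charge relation: `GΔ − ΔG = −Δ` and `G` Hermitian give `GΔᴴ − ΔᴴG = Δᴴ`. [folklore] -/
theorem charge_conjTranspose (hG : G.IsHermitian) (hch : G * Δ - Δ * G = -Δ) :
    G * Δᴴ - Δᴴ * G = Δᴴ := by
  have h := congrArg conjTranspose hch
  rw [conjTranspose_sub, conjTranspose_mul, conjTranspose_mul, hG.eq, conjTranspose_neg] at h
  -- `h : Δᴴ G − G Δᴴ = −Δᴴ`
  rw [← neg_sub, h, neg_neg]

omit [DecidableEq n] in
/-- `[A(h), G] = −h(Δ − Δᴴ)` for `A(h) = K − h(Δ + Δᴴ)`, `KG = GK`, `GΔ − ΔG = −Δ`, `G` Hermitian.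
[cite: PitaevskiiStringari1991, §2] -/
theorem sourced_comm_charge (hG : G.IsHermitian) (hKG : K * G = G * K) (hch : G * Δ - Δ * G = -Δ) (h : ℝ) :
    (K - (h : ℂ) • (Δ + Δᴴ)) * G - G * (K - (h : ℂ) • (Δ + Δᴴ)) = -((h : ℂ) • (Δ - Δᴴ)) := by
  have e1 : Δ * G = G * Δ + Δ := by
    have := sub_eq_iff_eq_add.1 hch  -- G Δ = -Δ + Δ G
    rw [this]; abel
  have e2 : Δᴴ * G = G * Δᴴ - Δᴴ := by
    have := sub_eq_iff_eq_add.1 (charge_conjTranspose hG hch)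
    rw [this]; abel
  rw [sub_mul, mul_sub, Matrix.smul_mul, Matrix.mul_smul, add_mul, mul_add, e1, e2, hKG, smul_add, smul_add,
    smul_sub, smul_add, smul_sub]
  abel

omit [DecidableEq n] in
/-- **(W) Ward identity**: `[G, [A(h), G]] = h·(Δ + Δᴴ)` — the `k = 0` transverse susceptibility sum rule of the
sourced problem (`A(h) = K − h(Δ + Δᴴ)`, `KG = GK`, `GΔ − ΔG = −Δ`, `G` Hermitian). [cite: PitaevskiiStringari1991, §2]
[cite: Wagner1966, §II] -/
theorem ward_doubleCommutator (hG : G.IsHermitian) (hKG : K * G = G * K) (hch : G * Δ - Δ * G = -Δ) (h : ℝ) :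
    G * ((K - (h : ℂ) • (Δ + Δᴴ)) * G - G * (K - (h : ℂ) • (Δ + Δᴴ))) -
        ((K - (h : ℂ) • (Δ + Δᴴ)) * G - G * (K - (h : ℂ) • (Δ + Δᴴ))) * G =
      (h : ℂ) • (Δ + Δᴴ) := by
  have e1 : Δ * G = G * Δ + Δ := by
    have := sub_eq_iff_eq_add.1 hch
    rw [this]; abel
  have e2 : Δᴴ * G = G * Δᴴ - Δᴴ := by
    have := sub_eq_iff_eq_add.1 (charge_conjTranspose hG hch)
    rw [this]; abel
  rw [sourced_comm_charge hG hKG hch h, Matrix.mul_neg, Matrix.neg_mul, Matrix.mul_smul, Matrix.smul_mul,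
    mul_sub, sub_mul, e1, e2]
  module

end Ward

/-! ### §2 The double-commutator block of a ground-state vector is positive semidefinite -/

section Block

variable {H : Matrix n n ℂ}

omit [DecidableEq n] in
/-- Adjoint move in dot-product form: `⟨ψ, M v⟩ = ⟨Mᴴψ, v⟩`. [folklore] -/
private theorem star_dotProduct_mulVec_eq_star_conjTranspose_mulVec (M : Matrix n n ℂ) (ψ v : n → ℂ) :
    star ψ ⬝ᵥ M *ᵥ v = star (Mᴴ *ᵥ ψ) ⬝ᵥ v := by
  rw [dotProduct_mulVec, star_mulVec, conjTranspose_conjTranspose]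

/-- **Entry identity.** For Hermitian `H` with `Hψ = E₀ψ` (`E₀` the ground energy) and any `X, Y`:
`⟨ψ, (Xᴴ[H,Y] − [H,Y]Xᴴ)ψ⟩ = ⟨Xψ, (H − E₀)Yψ⟩ + ⟨Yᴴψ, (H − E₀)Xᴴψ⟩` — the double commutator of a ground-state
vector is a sum of two energy forms of excited trial vectors. [cite: BratteliRobinsonII1997, Prop. 5.3.19]
[cite: PitaevskiiStringari1991, §2] -/
theorem star_dotProduct_doubleCommutator_mulVec (hH : H.IsHermitian) {ψ : n → ℂ}
    (hψ : H *ᵥ ψ = (H.groundEnergy : ℂ) • ψ) (X Y : Matrix n n ℂ) :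
    star ψ ⬝ᵥ (Xᴴ * (H * Y - Y * H) - (H * Y - Y * H) * Xᴴ) *ᵥ ψ =
      star (X *ᵥ ψ) ⬝ᵥ (H - algebraMap ℝ (Matrix n n ℂ) H.groundEnergy) *ᵥ (Y *ᵥ ψ) +
        star (Yᴴ *ᵥ ψ) ⬝ᵥ (H - algebraMap ℝ (Matrix n n ℂ) H.groundEnergy) *ᵥ (Xᴴ *ᵥ ψ) := by
  -- the first term: `⟨ψ, Xᴴ [H,Y] ψ⟩ = ⟨Xψ, (H − E₀) Yψ⟩`
  have hE1 : algebraMap ℝ (Matrix n n ℂ) H.groundEnergy *ᵥ (Y *ᵥ ψ) = (H.groundEnergy : ℂ) • (Y *ᵥ ψ) := by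
    rw [Algebra.algebraMap_eq_smul_one, smul_mulVec, one_mulVec, Complex.coe_smul]
  have h1 : star ψ ⬝ᵥ (Xᴴ * (H * Y - Y * H)) *ᵥ ψ =
      star (X *ᵥ ψ) ⬝ᵥ (H - algebraMap ℝ (Matrix n n ℂ) H.groundEnergy) *ᵥ (Y *ᵥ ψ) := by
    rw [← mulVec_mulVec, star_dotProduct_mulVec_eq_star_conjTranspose_mulVec Xᴴ ψ, conjTranspose_conjTranspose,
      sub_mulVec, ← mulVec_mulVec, ← mulVec_mulVec, hψ, mulVec_smul, sub_mulVec, hE1]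
  -- the second term: `⟨ψ, [H,Y] Xᴴ ψ⟩ = −⟨Yᴴψ, (H − E₀) Xᴴψ⟩`
  have hE : algebraMap ℝ (Matrix n n ℂ) H.groundEnergy *ᵥ (Xᴴ *ᵥ ψ) = (H.groundEnergy : ℂ) • (Xᴴ *ᵥ ψ) := by
    rw [Algebra.algebraMap_eq_smul_one, smul_mulVec, one_mulVec, Complex.coe_smul]
  have hψ' : star (H *ᵥ ψ) = (H.groundEnergy : ℂ) • star ψ := by
    rw [hψ, star_smul, Complex.star_def, Complex.conj_ofReal]
  have h2 : star ψ ⬝ᵥ ((H * Y - Y * H) * Xᴴ) *ᵥ ψ =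
      -(star (Yᴴ *ᵥ ψ) ⬝ᵥ (H - algebraMap ℝ (Matrix n n ℂ) H.groundEnergy) *ᵥ (Xᴴ *ᵥ ψ)) := by
    rw [← mulVec_mulVec, sub_mulVec, ← mulVec_mulVec, ← mulVec_mulVec, dotProduct_sub,
      star_dotProduct_mulVec_eq_star_conjTranspose_mulVec H ψ, hH.eq, hψ', smul_dotProduct,
      star_dotProduct_mulVec_eq_star_conjTranspose_mulVec Y ψ (Xᴴ *ᵥ ψ),
      star_dotProduct_mulVec_eq_star_conjTranspose_mulVec Y ψ (H *ᵥ (Xᴴ *ᵥ ψ)), sub_mulVec, hE, dotProduct_sub]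
    simp only [dotProduct_smul, smul_eq_mul]
    ring
  rw [sub_mulVec, dotProduct_sub, h1, h2, sub_neg_eq_add]

omit [DecidableEq n] in
/-- Entries of a rectangular Gram matrix `Vᴴ P V` as dot-product forms of its columns. [folklore] -/
private theorem conjTranspose_mul_mul_apply {m : Type*} (P : Matrix n n ℂ) (V : Matrix n m ℂ) (a b : m) :
    (Vᴴ * P * V) a b = star (fun i => V i a) ⬝ᵥ P *ᵥ (fun i => V i b) := by
  rw [Matrix.mul_assoc, Matrix.mul_apply]
  simp only [conjTranspose_apply, dotProduct, mulVec, Pi.star_apply, Matrix.mul_apply]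

/-- **(DCommBlockPSD) The `k = 0` double-commutator block is positive semidefinite.** For Hermitian `H`, a
ground-state vector `ψ` (`Matrix.IsGroundStateVector`: `ψ ≠ 0`, `Hψ = E₀ψ`) and ANY finite family of matrices
`X : m → Matrix n n ℂ`, the matrix `D_ab = ⟨ψ, ((X a)ᴴ[H, X b] − [H, X b](X a)ᴴ)ψ⟩` is `PosSemidef`
(`D = Vᴴ(H − E₀)V + (Wᴴ(H − E₀)W)ᵀ`, `V_{ib} = (X_b ψ)_i`, `W_{ib} = (X_bᴴ ψ)_i`). Its pairing with a multiplier
`Γ ⪰ 0` is the tree's `dcommForm` row; here the block itself is certified PSD, so Schur complements (the border) are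
available. [cite: PitaevskiiStringari1991, §2] [cite: BratteliRobinsonII1997, Prop. 5.3.19] -/
theorem posSemidef_doubleCommutatorBlock (hH : H.IsHermitian) {ψ : n → ℂ} (hψ : H.IsGroundStateVector ψ)
    {m : Type*} [Fintype m] (X : m → Matrix n n ℂ) :
    (Matrix.of fun a b : m =>
      star ψ ⬝ᵥ ((X a)ᴴ * (H * X b - X b * H) - (H * X b - X b * H) * (X a)ᴴ) *ᵥ ψ).PosSemidef := by
  set P : Matrix n n ℂ := H - algebraMap ℝ (Matrix n n ℂ) H.groundEnergy with hP
  have hPpsd : P.PosSemidef := posSemidef_sub_groundEnergy hH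
  set V : Matrix n m ℂ := Matrix.of fun i b => (X b *ᵥ ψ) i with hV
  set W : Matrix n m ℂ := Matrix.of fun i b => ((X b)ᴴ *ᵥ ψ) i with hW
  have hdec : (Matrix.of fun a b : m =>
      star ψ ⬝ᵥ ((X a)ᴴ * (H * X b - X b * H) - (H * X b - X b * H) * (X a)ᴴ) *ᵥ ψ) =
      Vᴴ * P * V + (Wᴴ * P * W)ᵀ := by
    ext a b
    rw [Matrix.of_apply, Matrix.add_apply, Matrix.transpose_apply, conjTranspose_mul_mul_apply,
      conjTranspose_mul_mul_apply, star_dotProduct_doubleCommutator_mulVec hH hψ.2 (X a) (X b)]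
    rfl
  rw [hdec]
  exact (hPpsd.conjTranspose_mul_mul_same V).add (hPpsd.conjTranspose_mul_mul_same W).transpose

/-- Diagonal entries of the block are the tree's one-generator `dcomm` rows:
`0 ≤ Re⟨ψ, (Yᴴ[H,Y] − [H,Y]Yᴴ)ψ⟩`. [cite: BratteliRobinsonII1997, Prop. 5.3.19] -/
theorem re_star_dotProduct_doubleCommutator_mulVec_nonneg (hH : H.IsHermitian) {ψ : n → ℂ}
    (hψ : H.IsGroundStateVector ψ) (Y : Matrix n n ℂ) :
    0 ≤ (star ψ ⬝ᵥ (Yᴴ * (H * Y - Y * H) - (H * Y - Y * H) * Yᴴ) *ᵥ ψ).re := by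
  have h := (posSemidef_doubleCommutatorBlock hH hψ (fun _ : Fin 1 => Y)).diag_nonneg (i := 0)
  rw [Matrix.of_apply] at h
  exact (Complex.nonneg_iff.1 h).1

end Block

/-! ### §3 The Ward–Bogoliubov scalar inequality (the BORDER row) -/

section Border

variable {K G Δ : Matrix n n ℂ}

/-- `2 × 2` positive semidefinite Hermitian-valued data: `0 ≤ a`, `0 ≤ d` real parts and `‖b‖² ≤ Re a · Re d` from
`PosSemidef !![a, b; c, d]`. [folklore] -/
private theorem normSq_le_of_posSemidef_fin_two {M : Matrix (Fin 2) (Fin 2) ℂ} (hM : M.PosSemidef) :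
    ‖M 0 1‖ ^ 2 ≤ (M 0 0).re * (M 1 1).re := by
  have hdet := hM.det_nonneg
  rw [det_fin_two] at hdet
  have h10 : M 1 0 = star (M 0 1) := (hM.isHermitian.apply 1 0).symm
  have h00 : M 0 0 = ((M 0 0).re : ℂ) := by
    have := hM.diag_nonneg (i := 0)
    apply Complex.ext <;> simp [(Complex.nonneg_iff.1 this).2.symm]
  have h11 : M 1 1 = ((M 1 1).re : ℂ) := by
    have := hM.diag_nonneg (i := 1)
    apply Complex.ext <;> simp [(Complex.nonneg_iff.1 this).2.symm]
  rw [h10, Complex.star_def, Complex.mul_conj, Complex.normSq_eq_norm_sq] at hdet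
  rw [h00, h11] at hdet
  have := (Complex.nonneg_iff.1 hdet).1
  simp only [Complex.sub_re, Complex.mul_re, Complex.ofReal_re, Complex.ofReal_im, mul_zero, sub_zero] at this
  linarith

/-- **(WBScalar) The Ward–Bogoliubov border inequality.** `K`, `G` Hermitian... precisely: `G` Hermitian, `K`
Hermitian, `KG = GK`, `GΔ − ΔG = −Δ`, `0 < h`; for every ground-state vector `ψ` of `A(h) = K − h(Δ + Δᴴ)` and EVERY
matrix `Y`:
`h · ‖⟨ψ, ((Δ − Δᴴ)Y − Y(Δ − Δᴴ))ψ⟩‖² ≤ Re⟨ψ, (Δ + Δᴴ)ψ⟩ · Re⟨ψ, (Yᴴ[A(h),Y] − [A(h),Y]Yᴴ)ψ⟩`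
(the `2 × 2` block `X = (G, Y)` of `posSemidef_doubleCommutatorBlock`: `(G,G)` entry `= h⟨O⟩` by the Ward identity,
off-diagonal `= h⟨[Δ − Δᴴ, Y]⟩` by Jacobi and the first-order row). With the rotated source `P = i(Δ − Δᴴ)` the left
side is `h‖⟨ψ,[P,Y]ψ⟩‖²` (`ward_bogoliubov_scalar_rotated`). [cite: PitaevskiiStringari1991, §2] [cite: Wagner1966, §II] -/
theorem ward_bogoliubov_scalar (hK : K.IsHermitian) (hG : G.IsHermitian) (hKG : K * G = G * K)
    (hch : G * Δ - Δ * G = -Δ) {h : ℝ} (hh : 0 < h) {ψ : n → ℂ}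
    (hψ : (K - (h : ℂ) • (Δ + Δᴴ)).IsGroundStateVector ψ) (Y : Matrix n n ℂ) :
    h * ‖star ψ ⬝ᵥ ((Δ - Δᴴ) * Y - Y * (Δ - Δᴴ)) *ᵥ ψ‖ ^ 2 ≤
      (star ψ ⬝ᵥ (Δ + Δᴴ) *ᵥ ψ).re *
        (star ψ ⬝ᵥ (Yᴴ * ((K - (h : ℂ) • (Δ + Δᴴ)) * Y - Y * (K - (h : ℂ) • (Δ + Δᴴ))) -
          ((K - (h : ℂ) • (Δ + Δᴴ)) * Y - Y * (K - (h : ℂ) • (Δ + Δᴴ))) * Yᴴ) *ᵥ ψ).re := by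
  set A : Matrix n n ℂ := K - (h : ℂ) • (Δ + Δᴴ) with hA
  have hAh : A.IsHermitian := by
    rw [hA]
    refine hK.sub (IsHermitian.smul (isHermitian_add_transpose_self Δ) ?_)
    rw [isSelfAdjoint_iff, Complex.star_def, Complex.conj_ofReal]
  -- the 2 × 2 block with generators (G, Y)
  set X : Fin 2 → Matrix n n ℂ := ![G, Y] with hX
  have hblock := posSemidef_doubleCommutatorBlock hAh hψ X
  have hineq := normSq_le_of_posSemidef_fin_two hblock
  simp only [Matrix.of_apply, hX, Matrix.cons_val_zero, Matrix.cons_val_one] at hineq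
  -- (G,G) entry: Ward
  have hGG : star ψ ⬝ᵥ (Gᴴ * (A * G - G * A) - (A * G - G * A) * Gᴴ) *ᵥ ψ =
      (h : ℂ) * (star ψ ⬝ᵥ (Δ + Δᴴ) *ᵥ ψ) := by
    rw [hG.eq, hA, ward_doubleCommutator hG hKG hch h, smul_mulVec, dotProduct_smul, smul_eq_mul]
  -- (G,Y) entry: Jacobi + first-order row
  have hGY : star ψ ⬝ᵥ (Gᴴ * (A * Y - Y * A) - (A * Y - Y * A) * Gᴴ) *ᵥ ψ =
      (h : ℂ) * (star ψ ⬝ᵥ ((Δ - Δᴴ) * Y - Y * (Δ - Δᴴ)) *ᵥ ψ) := by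
    have hcomm := sourced_comm_charge hG hKG hch h
    rw [← hA] at hcomm
    -- `Gᴴ[A,Y] − [A,Y]Gᴴ = [[G,A],Y] + [A,[G,Y]]`, and `[G,A] = h(Δ − Δᴴ)`
    have hGA : G * A - A * G = (h : ℂ) • (Δ - Δᴴ) := by
      rw [← neg_sub, hcomm, neg_neg]
    have hjac : Gᴴ * (A * Y - Y * A) - (A * Y - Y * A) * Gᴴ =
        ((G * A - A * G) * Y - Y * (G * A - A * G)) + (A * (G * Y - Y * G) - (G * Y - Y * G) * A) := by
      rw [hG.eq]; noncomm_ring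
    rw [hjac, add_mulVec, dotProduct_add, dotProduct_comm_mulVec_eq_zero hAh hψ.2 (G * Y - Y * G), add_zero, hGA,
      Matrix.smul_mul, Matrix.mul_smul, ← smul_sub, smul_mulVec, dotProduct_smul, smul_eq_mul]
  rw [hGG, hGY, norm_mul, mul_pow, Complex.norm_real, Real.norm_eq_abs, abs_of_pos hh, Complex.re_ofReal_mul]
    at hineq
  -- `h² ‖c‖² ≤ h·Re⟨O⟩·Re D_YY` ⇒ divide by `h > 0`
  have key : h * (h * ‖star ψ ⬝ᵥ ((Δ - Δᴴ) * Y - Y * (Δ - Δᴴ)) *ᵥ ψ‖ ^ 2) ≤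
      h * ((star ψ ⬝ᵥ (Δ + Δᴴ) *ᵥ ψ).re *
        (star ψ ⬝ᵥ (Yᴴ * (A * Y - Y * A) - (A * Y - Y * A) * Yᴴ) *ᵥ ψ).re) := by
    have e1 : h * (h * ‖star ψ ⬝ᵥ ((Δ - Δᴴ) * Y - Y * (Δ - Δᴴ)) *ᵥ ψ‖ ^ 2) =
        h ^ 2 * ‖star ψ ⬝ᵥ ((Δ - Δᴴ) * Y - Y * (Δ - Δᴴ)) *ᵥ ψ‖ ^ 2 := by ring
    rw [e1, ← mul_assoc]
    exact hineq
  exact le_of_mul_le_mul_left key hh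

/-- The border inequality with the ROTATED source `P = i(Δ − Δᴴ)` (Hermitian), verbatim transplant-2's `WBScalar`:
`h·‖⟨ψ,[P,Y]ψ⟩‖² ≤ Re⟨ψ,Oψ⟩ · Re⟨ψ,[Yᴴ,[A(h),Y]]ψ⟩`. [cite: PitaevskiiStringari1991, §2] [cite: Wagner1966, §II] -/
theorem ward_bogoliubov_scalar_rotated (hK : K.IsHermitian) (hG : G.IsHermitian) (hKG : K * G = G * K)
    (hch : G * Δ - Δ * G = -Δ) {h : ℝ} (hh : 0 < h) {ψ : n → ℂ}
    (hψ : (K - (h : ℂ) • (Δ + Δᴴ)).IsGroundStateVector ψ) (Y : Matrix n n ℂ) :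
    h * ‖star ψ ⬝ᵥ ((Complex.I • (Δ - Δᴴ)) * Y - Y * (Complex.I • (Δ - Δᴴ))) *ᵥ ψ‖ ^ 2 ≤
      (star ψ ⬝ᵥ (Δ + Δᴴ) *ᵥ ψ).re *
        (star ψ ⬝ᵥ (Yᴴ * ((K - (h : ℂ) • (Δ + Δᴴ)) * Y - Y * (K - (h : ℂ) • (Δ + Δᴴ))) -
          ((K - (h : ℂ) • (Δ + Δᴴ)) * Y - Y * (K - (h : ℂ) • (Δ + Δᴴ))) * Yᴴ) *ᵥ ψ).re := by
  have e : (Complex.I • (Δ - Δᴴ)) * Y - Y * (Complex.I • (Δ - Δᴴ)) =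
      Complex.I • ((Δ - Δᴴ) * Y - Y * (Δ - Δᴴ)) := by
    rw [Matrix.smul_mul, Matrix.mul_smul, smul_sub]
  rw [e, smul_mulVec, dotProduct_smul, smul_eq_mul, norm_mul, Complex.norm_I, one_mul]
  exact ward_bogoliubov_scalar hK hG hKG hch hh hψ Y

/-- **The border row as a response FLOOR.** In the setting of `ward_bogoliubov_scalar`, if the torque is
certified STRICTLY from below, `0 < c ≤ ‖⟨ψ,[Δ − Δᴴ, Y]ψ⟩‖`, and the `Y`-row value from above,
`Re⟨ψ,[Yᴴ,[A,Y]]ψ⟩ ≤ d` with `0 < d`, then `h·c²/d ≤ Re⟨ψ,(Δ + Δᴴ)ψ⟩` (in particular the one-point function is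
positive). [cite: PitaevskiiStringari1991, §2] -/
theorem re_source_ge_of_ward_bogoliubov (hK : K.IsHermitian) (hG : G.IsHermitian) (hKG : K * G = G * K)
    (hch : G * Δ - Δ * G = -Δ) {h : ℝ} (hh : 0 < h) {ψ : n → ℂ}
    (hψ : (K - (h : ℂ) • (Δ + Δᴴ)).IsGroundStateVector ψ) (Y : Matrix n n ℂ) {c d : ℝ} (hc : 0 < c)
    (hcle : c ≤ ‖star ψ ⬝ᵥ ((Δ - Δᴴ) * Y - Y * (Δ - Δᴴ)) *ᵥ ψ‖) (hd : 0 < d)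
    (hdle : (star ψ ⬝ᵥ (Yᴴ * ((K - (h : ℂ) • (Δ + Δᴴ)) * Y - Y * (K - (h : ℂ) • (Δ + Δᴴ))) -
          ((K - (h : ℂ) • (Δ + Δᴴ)) * Y - Y * (K - (h : ℂ) • (Δ + Δᴴ))) * Yᴴ) *ᵥ ψ).re ≤ d) :
    h * c ^ 2 / d ≤ (star ψ ⬝ᵥ (Δ + Δᴴ) *ᵥ ψ).re := by
  have hwb := ward_bogoliubov_scalar hK hG hKG hch hh hψ Y
  set o := (star ψ ⬝ᵥ (Δ + Δᴴ) *ᵥ ψ).re with ho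
  set dd := (star ψ ⬝ᵥ (Yᴴ * ((K - (h : ℂ) • (Δ + Δᴴ)) * Y - Y * (K - (h : ℂ) • (Δ + Δᴴ))) -
          ((K - (h : ℂ) • (Δ + Δᴴ)) * Y - Y * (K - (h : ℂ) • (Δ + Δᴴ))) * Yᴴ) *ᵥ ψ).re with hdd
  have hA : (K - (h : ℂ) • (Δ + Δᴴ)).IsHermitian := by
    refine hK.sub (IsHermitian.smul (isHermitian_add_transpose_self Δ) ?_)
    rw [isSelfAdjoint_iff, Complex.star_def, Complex.conj_ofReal]
  have hdd0 : 0 ≤ dd := re_star_dotProduct_doubleCommutator_mulVec_nonneg hA hψ Y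
  have h1 : h * c ^ 2 ≤ h * ‖star ψ ⬝ᵥ ((Δ - Δᴴ) * Y - Y * (Δ - Δᴴ)) *ᵥ ψ‖ ^ 2 :=
    mul_le_mul_of_nonneg_left (pow_le_pow_left₀ hc.le hcle 2) hh.le
  have h2 : h * c ^ 2 ≤ o * dd := h1.trans hwb
  have hpos : 0 < h * c ^ 2 := by positivity
  have ho0 : 0 < o := by
    by_contra hneg
    have h3 : o * dd ≤ 0 := mul_nonpos_of_nonpos_of_nonneg (not_lt.1 hneg) hdd0
    linarith
  rw [div_le_iff₀ hd]
  exact h2.trans (mul_le_mul_of_nonneg_left hdle ho0.le)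

end Border

end Summit.Ventures.CertifiedManyBodySolver.Observables

end
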